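import Mathlib
import HarnessLib
import Summits.FinalStateConjecture.FinalStateConjecture.Theorems.LogTimeThreeAnnuliDyadicCaptureFreezingB
import Summits.FinalStateConjecture.FinalStateConjecture.Theorems.LogTimeThreeAnnuliDyadicCaptureFreezingC
import Literature.Geometry.Lorentzian.QuasiFinalStateDecomposition

/-!
# Route LogTimeThreeAnnuli · crux `DyadicCapture` · line `registered` — frozen members are unique

`stub_frozenMemberUnique`: over ANY spacetime `𝓢` and ANY chart `Ψ` on a reference boosted Kerr
exterior `boostedKerrExterior Λ c M_r a_r`, two members `(M, a)`, `(M', a')` of `{M > 0}` whose boosted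
Kerr–Schild forms `g_{M,a}`, `g_{M',a'}` are both `C⁰` limits of `Ψ^* g` on every fixed truncated slab
`{t* = τ, r ≤ ρ}` of the reference background (truncated `C⁰` deviation `→ 0` as `τ → ∞`, for every
radius `ρ`) coincide (`frozenMemberUnique_of_tendsto`); specialised to the reference chart `d.chart i`
of a quasi final-state decomposition this is the registered stub.

Proof: take the anchor `y₀ = (0, 0, s, s)` of the reference exterior (`freezing_exists_anchor`) and its
boosted image `x₀ = c + Λy₀`, `ρ = r_{a_r}(y₀)`. For every `τ` the time-translate `x₀ + τΛe₀` lies in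
the truncated slab of radius `ρ` at time `τ` (`freezing_mem_slab_iff`, `freezing_add_smul_mem_slab`),
so by stationarity of the family along the Killing orbit (`freezing_enorm_anchor_sub_le`) the CONSTANT
`‖g_{M,a}(x₀) − g_{M',a'}(x₀)‖` is at most the sum of the two truncated `C⁰` deviations at time `τ`,
which tends to `0`; hence the two forms agree at `x₀` and the injectivity of the family at the anchor
(`freezing_anchor_injective`, i.e. `stub_kerrSchildRigidity` (i) boosted) gives `(M, a) = (M', a')`.
Sources: Kerr–Schild 1965 §2 (stationarity, the explicit form); DHRT arXiv:2104.08222 §1 (the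
deviation norms).
-/

-- the `Summit.FinalStateConjecture.FinalStateConjecture.…` namespace repeats the summit = sub-problem
-- segment (D-0017 layout, CONVENTIONS §2); the duplicate is deliberate.
set_option linter.dupNamespace false

noncomputable section

namespace Summit.FinalStateConjecture.FinalStateConjecture.Theorems

open Literature.Geometry.Lorentzian
open scoped Topology Manifold ENNReal ContDiff
open Filter Set

section Chart

variable {𝓢 : Spacetime.{0} 4} (Λ : lorentzGroup) (c : E4) (Mr ar : ℝ)
  (Ψ : (boostedKerrExterior Λ c Mr ar) → 𝓢.carrier)

/-- The boosted anchor translate `(c + Λy₀) + τΛe₀` of a rest-frame point `y₀` of the reference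
exterior with `y₀ 0 = 0` lies in the truncated slab of radius `r_{a_r}(y₀)` at rest-frame time `τ` of
every window background `{boostedKerrBackground Λ c M_r a_r with bilin := b}`. [folklore] -/
theorem frozenMemberUnique_translate_mem_slab (b : E4 → E4 →L[ℝ] E4 →L[ℝ] ℝ) {y₀ : E4} (h0 : y₀ 0 = 0)
    (hy₀ : max (Kerr.rPlus Mr ar) 0 < Kerr.radius ar y₀) (τ : ℝ) :
    (c + (Λ : E4 ≃L[ℝ] E4) y₀) + τ • (Λ : E4 ≃L[ℝ] E4) (EuclideanSpace.single (0 : Fin 4) (1 : ℝ)) ∈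
      Subtype.val '' ({boostedKerrBackground Λ c Mr ar with bilin := b} : ModelBackground).truncTimeSlab
        (Kerr.radius ar y₀) τ := by
  have hstart : c + (Λ : E4 ≃L[ℝ] E4) y₀ ∈ Subtype.val ''
      ({boostedKerrBackground Λ c Mr ar with bilin := b} : ModelBackground).truncTimeSlab
        (Kerr.radius ar y₀) 0 := by
    rw [freezing_mem_slab_iff]
    refine ⟨freezing_boost_mem_exterior hy₀, ?_, ?_⟩
    · rw [freezing_poincareInv_boost]
      exact h0
    · rw [freezing_poincareInv_boost]
  have h := freezing_add_smul_mem_slab Λ c Mr ar b hstart τ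
  rwa [zero_add] at h

/-- **Two members of `{M > 0}` that are both `C⁰` limits of one chart coincide.** If the truncated
`C⁰` deviations of `Ψ^* g` from `g_{M,a}` and from `g_{M',a'}` on the slabs `{t* = τ, r ≤ ρ}` of the
reference background both tend to `0` as `τ → ∞` for every `ρ`, then `(M, a) = (M', a')`: at the
boosted anchor the two (stationary) forms differ by at most the two deviations at the time-translate
(`freezing_enorm_anchor_sub_le`), so they agree there, and the family is injective at the anchor
(`freezing_anchor_injective`). [cite: KerrSchild1965, §2] -/
theorem frozenMemberUnique_of_tendsto {M a M' a' : ℝ} (hM : 0 < M) (hM' : 0 < M')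
    (hP : ∀ ρ : ℝ, Tendsto (fun τ ↦ 𝓢.truncDeviationCk ({boostedKerrBackground Λ c Mr ar with
      bilin := boostedKerrBilin Λ c M a} : ModelBackground) Ψ 0 ρ τ) atTop (𝓝 0))
    (hQ : ∀ ρ : ℝ, Tendsto (fun τ ↦ 𝓢.truncDeviationCk ({boostedKerrBackground Λ c Mr ar with
      bilin := boostedKerrBilin Λ c M' a'} : ModelBackground) Ψ 0 ρ τ) atTop (𝓝 0)) :
    M = M' ∧ a = a' := by
  obtain ⟨y₀, h0, h1, h2, h3, hy₀⟩ := freezing_exists_anchor Mr ar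
  have hx₀U : c + (Λ : E4 ≃L[ℝ] E4) y₀ ∈ (boostedKerrExterior Λ c Mr ar : Set E4) :=
    freezing_boost_mem_exterior hy₀
  -- each deviation value at the anchor translate is bounded by the truncated `C⁰` deviation
  have hpt : ∀ (q : ℝ × ℝ) (τ : ℝ),
      ‖𝓢.deviationExtend ({boostedKerrBackground Λ c Mr ar with
          bilin := boostedKerrBilin Λ c q.1 q.2} : ModelBackground) Ψ
        ((c + (Λ : E4 ≃L[ℝ] E4) y₀) + τ • (Λ : E4 ≃L[ℝ] E4) (EuclideanSpace.single (0 : Fin 4) (1 : ℝ)))‖ₑ ≤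
      𝓢.truncDeviationCk ({boostedKerrBackground Λ c Mr ar with
          bilin := boostedKerrBilin Λ c q.1 q.2} : ModelBackground) Ψ 0 (Kerr.radius ar y₀) τ := by
    intro q τ
    have hj := freezing_enorm_iteratedFDeriv_le_truncDeviationCk (𝓢 := 𝓢) (boostedKerrBackground Λ c Mr ar)
      Ψ (boostedKerrBilin Λ c q.1 q.2) (Nat.zero_le 0)
      (frozenMemberUnique_translate_mem_slab Λ c Mr ar (boostedKerrBilin Λ c q.1 q.2) h0 hy₀ τ)
    rwa [freezing_enorm_iteratedFDeriv_zero] at hj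
  -- the constant anchor difference is bounded by a null function of `τ`
  have hle : ∀ τ : ℝ,
      ‖boostedKerrBilin Λ c M a (c + (Λ : E4 ≃L[ℝ] E4) y₀) -
          boostedKerrBilin Λ c M' a' (c + (Λ : E4 ≃L[ℝ] E4) y₀)‖ₑ ≤
        𝓢.truncDeviationCk ({boostedKerrBackground Λ c Mr ar with
            bilin := boostedKerrBilin Λ c M a} : ModelBackground) Ψ 0 (Kerr.radius ar y₀) τ +
          𝓢.truncDeviationCk ({boostedKerrBackground Λ c Mr ar with
            bilin := boostedKerrBilin Λ c M' a'} : ModelBackground) Ψ 0 (Kerr.radius ar y₀) τ :=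
    fun τ ↦ (freezing_enorm_anchor_sub_le Λ c Mr ar Ψ hx₀U (M, a) (M', a') τ).trans
      (add_le_add (hpt (M, a) τ) (hpt (M', a') τ))
  have hlim : Tendsto (fun τ : ℝ ↦
      𝓢.truncDeviationCk ({boostedKerrBackground Λ c Mr ar with
          bilin := boostedKerrBilin Λ c M a} : ModelBackground) Ψ 0 (Kerr.radius ar y₀) τ +
        𝓢.truncDeviationCk ({boostedKerrBackground Λ c Mr ar with
          bilin := boostedKerrBilin Λ c M' a'} : ModelBackground) Ψ 0 (Kerr.radius ar y₀) τ)
      atTop (𝓝 0) := by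
    have h := (hP (Kerr.radius ar y₀)).add (hQ (Kerr.radius ar y₀))
    rwa [add_zero] at h
  have h0e : ‖boostedKerrBilin Λ c M a (c + (Λ : E4 ≃L[ℝ] E4) y₀) -
      boostedKerrBilin Λ c M' a' (c + (Λ : E4 ≃L[ℝ] E4) y₀)‖ₑ = 0 :=
    le_antisymm (ge_of_tendsto' hlim hle) bot_le
  rw [← ofReal_norm, ENNReal.ofReal_eq_zero] at h0e
  have hxy : boostedKerrBilin Λ c M a (c + (Λ : E4 ≃L[ℝ] E4) y₀) =
      boostedKerrBilin Λ c M' a' (c + (Λ : E4 ≃L[ℝ] E4) y₀) :=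
    sub_eq_zero.1 (norm_le_zero_iff.1 h0e)
  have hpq : ((M, a) : ℝ × ℝ) = (M', a') := freezing_anchor_injective h1 h2 h3 hM hM' hxy
  exact ⟨congrArg Prod.fst hpq, congrArg Prod.snd hpq⟩

end Chart

/-- **Stub U — frozen members are unique**: two members `(M, a)`, `(M', a')` of `{M > 0}` whose boosted
Kerr–Schild forms are both `C⁰` limits of `(chart i)^* g` on EVERY fixed slab `{t*ᵢ = τ, rᵢ ≤ ρ}` of the
reference background `d.background i` coincide (`frozenMemberUnique_of_tendsto` for the reference chart;
`d.background i` is `boostedKerrBackground Λᵢ cᵢ (d.mass i) (d.spin i)` by definition).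
[cite: KerrSchild1965, §2] -/
theorem stub_frozenMemberUnique : ∀ (𝓢 : Spacetime.{0} 4) (O : Set 𝓢.carrier) (d : QuasiFinalStateDecomposition 𝓢 O 2 ⊤) (i : Fin d.N) (M a M' a' : ℝ), 0 < M → 0 < M' → (∀ ρ : ℝ, Filter.Tendsto (fun τ => 𝓢.truncDeviationCk {d.background i with bilin := boostedKerrBilin (d.motion i).1 (d.motion i).2 M a} (d.chart i) 0 ρ τ) Filter.atTop (nhds 0)) → (∀ ρ : ℝ, Filter.Tendsto (fun τ => 𝓢.truncDeviationCk {d.background i with bilin := boostedKerrBilin (d.motion i).1 (d.motion i).2 M' a'} (d.chart i) 0 ρ τ) Filter.atTop (nhds 0)) → M = M' ∧ a = a' :=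
  fun _ _ d i _ _ _ _ hM hM' hP hQ ↦
    frozenMemberUnique_of_tendsto (d.motion i).1 (d.motion i).2 (d.mass i) (d.spin i) (d.chart i) hM hM' hP hQ

end Summit.FinalStateConjecture.FinalStateConjecture.Theorems

end
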